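import Summits.PneNP.PneNP.Theses.KrwChromaticSteering
import Summits.PneNP.PneNP.Theorems.KrwChromaticSteeringCompositionIterationIterate
import Literature.Computability.Complexity.KWDepthHardFunctions
import HarnessLib

/-!
# Crux `StandardFromStrong` (stmt-PneNP-18539): the quantifier order `∃ g₀ ∀ g` is load-bearing

Negative lemma of the refuter seat (pnp-krw-ref-1, 2026-08-27) for crux C2 of route
`KrwChromaticSteering`.  C2: for every non-constant `f` SOME `g₀` makes every standard protocol for
`KW_{f ⋄ g₀}` convertible, for EVERY `g`, into a strong protocol for `KW_f ⊛ KW_g` at cost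
`O(log (m n))`.  C2 follows from the weak KRW conjecture (crux work file
`Cruxes/StandardFromStrong/Disproof.lean`, via `standardFromStrong_of_weakKRW`), so it has no
refutation short of `¬ weak KRW`; its two hypotheses (`1 ≤ n`, `f` non-constant) are decoration
(`standardFromStrongNoHyps_iff` there).  What IS load-bearing is the order of quantifiers:

* `not_standardFromStrong_forall_g0` — the `∀ g₀` form is false, unconditionally: at `m = 1` with
  `f`, `g₀` dictators the standard game `KW_{f ⋄ g₀}` has the depth-`0` protocol `leaf (0,0)`, while
  for a depth-hard `g` (`DepthHardFunctionsExist_holds`, `c₀ = 8`) every strong protocol for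
  `KW_f ⊛ KW_g` is a `KW_g` protocol (`solves_of_solvesStrong_one`) of depth
  `≥ n − c₀ (⌊log₂ n⌋ + 1)`.  Hence the `g₀` of any proof of C2 must be depth-hard.
-/

set_option linter.dupNamespace false
set_option autoImplicit false

open Literature.Computability.Complexity
open Summit.PneNP.PneNP.Theorems.KrwCompositionIteration (exists_mul_succ_lt_two_pow)

namespace Summit.PneNP.PneNP.Theorems.StandardFromStrong.Negative

/-- At `m = 1` with `f` the dictator `a ↦ a 0`, a strong protocol for `KW_f ⊛ KW_g` IS a `KW_g`
protocol of the same depth: pull it back along `u ↦ (p ↦ u p.2)` and read the entry's column.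
[folklore] -/
theorem solves_of_solvesStrong_one {n : ℕ} {g : (Fin n → Bool) → Bool}
    {P' : KWTree (Fin 1 × Fin n)} (hP' : P'.SolvesStrong (fun a => a 0) g) :
    (P'.comap (fun u p => u p.2) (fun u p => u p.2) Prod.snd).Solves g := by
  intro u v hu hv
  rw [KWTree.run_comap]
  exact (hP' (fun p => u p.2) (fun p => v p.2)
    (by simp only [blockComp_apply, rowLabels_apply]; exact hu)
    (by simp only [blockComp_apply, rowLabels_apply]; exact hv)).1

/-- **The `∀ g₀` strengthening of `StandardFromStrong` is false.**  Witness: `m = 1`, `f a = a 0`,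
`g₀ u = u 0`, `P = leaf (0, 0)` (depth `0`; it solves `KW_{f ⋄ g₀}` since the entry `(0, 0)` carries
the value of `f ⋄ g₀`), `g` depth-hard from `DepthHardFunctionsExist_holds`, `n = 2^t` with
`(c + c₀)(t + 1) < 2^t`: the promised strong protocol of depth `≤ c (t + 1)` would be a `KW_g`
protocol of depth `< 2^t − c₀ (t + 1)`. [folklore; cite: JuknaBFC2012, Thm. 1.23 (Riordan–Shannon
counting behind `DepthHardFunctionsExist_holds`)] -/
theorem not_standardFromStrong_forall_g0 :
    ¬ ∃ c : ℕ, ∀ m n : ℕ, 1 ≤ n → ∀ f : (Fin m → Bool) → Bool, (∃ a b, f a ≠ f b) →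
      ∀ g₀ g : (Fin n → Bool) → Bool,
        ∀ P : KWTree (Fin m × Fin n), P.Solves (blockComp f g₀) →
          ∃ P' : KWTree (Fin m × Fin n), P'.SolvesStrong f g ∧
            P'.depth ≤ P.depth + c * (Nat.log 2 (m * n) + 1) := by
  rintro ⟨c, h⟩
  obtain ⟨c₀, hhard⟩ := DepthHardFunctionsExist_holds
  obtain ⟨t, ht⟩ := exists_mul_succ_lt_two_pow (c + c₀)
  have hn : 1 ≤ 2 ^ t := Nat.one_le_two_pow
  obtain ⟨g, hg⟩ := hhard (2 ^ t) hn
  let j0 : Fin (2 ^ t) := ⟨0, hn⟩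
  obtain ⟨P', hP', hd⟩ := h 1 (2 ^ t) hn (fun a => a 0) ⟨fun _ => true, fun _ => false, by simp⟩
    (fun u => u j0) g (KWTree.leaf ((0 : Fin 1), j0))
    (by
      intro X Y hX hY
      simp only [blockComp_apply, rowLabels_apply, row_apply] at hX hY
      simp [hX, hY])
  have h1 := hg _ (solves_of_solvesStrong_one hP')
  rw [KWTree.depth_comap, Nat.log_pow one_lt_two] at h1
  rw [KWTree.depth_leaf, one_mul, Nat.log_pow one_lt_two] at hd
  have hsplit : (c + c₀) * (t + 1) = c * (t + 1) + c₀ * (t + 1) := by ring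
  omega

end Summit.PneNP.PneNP.Theorems.StandardFromStrong.Negative
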